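import Literature.IUT.HodgeTheaters.AutHolSpaceNFRetyped
import Literature.IUT.HodgeTheaters.AutHolSpaceNFFunctorialityRepaired
import HarnessLib

/-!
# [IUTchI] Rmk 3.4.3 (ii): the re-typed functoriality predicate HOLDS at the genuine model

S. Mochizuki, *Inter-universal Teichmüller theory I*, §3, Remark 3.4.3 (ii), kurims p. 83
[cite: Mochizuki2012, Rmk 3.4.3 (ii) p.83] [claim: Mochizuki2012, status: disputed].  The instance of
the repaired reading at the genuine model, in the vocabulary of the re-typed record
(`AutHolSpaceNFRetyped.lean`, abc-iut-L5-lead RULINGS #39 (2)): for the Aut-holomorphic space `X` of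
`P¹_ℚ ∖ {0,1,∞}` (`S3RemarksLocal.AutHolSpaceNFStr.nonempty_model`), `NFPointsFunctorial' X X` holds —
by `S3RemarksLocal.AutHolSpaceNF.image_nfPoints_eq_of_isMorphism_model`
(`AutHolSpaceNFFunctorialityRepaired.lean`: [AbsTopIII] Cor. 2.3 (i) as proved by abc-iut-L4 +
`Aut^hol(ℂ ∖ {0,1}) = S₃`).  Proof-only; seat abc-iut-L6-t15 gen 4.  No side taken on [IUTchIII] Cor. 3.12.
-/

noncomputable section

namespace Literature.IUT.HodgeTheaters

open _root_.TopologicalSpace (Opens)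
open Literature.AnabelianGeometry.AbsoluteAnabelian

/-- **[IUTchI] Rmk 3.4.3 (ii), re-typed reading, HOLDS at the genuine model `P¹_ℚ ∖ {0,1,∞}`**:
`NFPointsFunctorial' X X` for `X` = (`ℂ ∖ {0,1}`, its Aut-holomorphic structure `AutHolStructure.ofCharted`,
its `ℚ̄`-points).  Contrast: the frozen reading `NFPointsFunctorial` FAILS at the corresponding model
(`S3RemarksLocal.AutHolSpaceNF.not_nfPointsFunctorial_model`). [cite: Mochizuki2012, Rmk 3.4.3 (ii) p.83] -/
theorem S3RemarksLocal.AutHolSpaceNFStr.nfPointsFunctorial'_model :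
    let U : Opens ℂ := ⟨{z : ℂ | z ≠ 0 ∧ z ≠ 1}, isOpen_ne.inter isOpen_ne⟩
    let X : S3RemarksLocal.AutHolSpaceNFStr.{0} :=
      { carrier := ↥U, str := AutHolStructure.ofCharted ↥U, nfPoints := {x | IsAlgebraic ℚ (x : ℂ)} }
    NFPointsFunctorial' X X := by
  intro U X α hα
  exact S3RemarksLocal.AutHolSpaceNF.image_nfPoints_eq_of_isMorphism_model α hα.1

/-- Packaged: there is a GENUINE-model inhabitant of the re-typed record at which the re-typed reading of
Rmk 3.4.3 (ii) holds. [cite: Mochizuki2012, Rmk 3.4.3 (ii) p.83] -/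
theorem S3RemarksLocal.AutHolSpaceNFStr.exists_model_nfPointsFunctorial' :
    ∃ X : S3RemarksLocal.AutHolSpaceNFStr.{0},
      X = { carrier := ↥(⟨{z : ℂ | z ≠ 0 ∧ z ≠ 1}, isOpen_ne.inter isOpen_ne⟩ : Opens ℂ)
            str := AutHolStructure.ofCharted
              ↥(⟨{z : ℂ | z ≠ 0 ∧ z ≠ 1}, isOpen_ne.inter isOpen_ne⟩ : Opens ℂ)
            nfPoints := {x | IsAlgebraic ℚ (x : ℂ)} } ∧
      NFPointsFunctorial' X X :=
  ⟨_, rfl, S3RemarksLocal.AutHolSpaceNFStr.nfPointsFunctorial'_model⟩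

end Literature.IUT.HodgeTheaters

end
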